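import Summits.KontsevichZagierPeriods.KontsevichZagierPeriods.Theorems.RootDecompRelativeModAbsoluteCylLogSplitP36

/-! # `RootDecompRelativeModAbsoluteCylLogSplitP37` — part 12/27 of the mechanical ≤400-line split of `RungClosure.lean` (sha256 f909f334226f0fb5…)
Source: decomp-kz lens-3 g12 `RungClosure.lean` v9 (HOME/decomp-kz-lens-3/g12/, sha256 f909f334…; critic g4-52/g4-57/g5 CLEARED, «lander: split v9 --supports 30572»): BLOCK I (57 g11 monolith decls missing from P01–P25), BLOCK II/III (WildCertAssembly parts 1–6, 8–10: `Leaf.cellLocalWildCert`, `Leaf.cylKernelZeroLog_of_trees`), Parts 12–13 (`Leaf.regKernelPairDegOne_iff_circlePos_of_trees`), BLOCK G13 (Möbius engine, test §C decided).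
Split by census-1 g9 `gen/splitlean.py`: scopes re-opened with their `open`/`variable`/`set_option` context; mathematics and declaration order unchanged. -/

noncomputable section
open Set MeasureTheory Filter Topology
open scoped BigOperators
open Literature.NumberTheory.Transcendental Literature.ModelTheory.ExponentialFields
namespace Summit.KontsevichZagierPeriods.RootDecompRelativeModAbsolute.Rung30571.RegularisedLogLayer.CylLogLeaf

/-- **T2 `rates_at_end`.**  Finitely many one-variable `ℚ`-semialgebraic `κᵢ`, non-vanishing on the cell and tending to `0` at the
end `a⁺`: for every raising exponent `m ≥ m₀` the ratios `|κᵢ|^{m+1}/|κ_k|^{M_k+1}` are bounded near `a` (and `|κᵢ| ≤ 1` there). -/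
theorem rates_at_end {ι : Type*} [Fintype ι] (κ : ι → ℝ → ℝ) (M : ι → ℕ) {a c : ℝ} (hac : a < c)
    (hκ : ∀ i, IsSemialgebraicFunOn ℚ {x : Fin 1 → ℝ | x 0 ∈ Set.Ioo a c} (fun x => κ i (x 0)))
    (h0 : ∀ i, Tendsto (κ i) (𝓝[>] a) (𝓝 0)) (hne : ∀ i, ∀ t ∈ Set.Ioo a c, κ i t ≠ 0) :
    ∃ (m₀ : ℕ) (δ : ℝ), 0 < δ ∧ δ ≤ 1 ∧ a + δ ≤ c ∧ (∀ i, ∀ t ∈ Set.Ioo a (a + δ), |κ i t| ≤ 1) ∧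
      ∀ m, m₀ ≤ m → ∀ i k, ∃ C : ℝ, ∀ t ∈ Set.Ioo a (a + δ), |κ i t| ^ (m + 1) / |κ k t| ^ (M k + 1) ≤ C := by
  classical
  -- per-index data
  choose N Cu δu hN hCu hδu hδu1 hδuc hbu using fun i => upper_root_bound hac (hκ i) (h0 i)
  choose K Cl δl hCl hδl hδlc hbl using fun k => lower_power_bound hac (hκ k) (hne k)
  rcases isEmpty_or_nonempty ι with hι | hι
  · refine ⟨0, min 1 (c - a), lt_min one_pos (sub_pos.2 hac), min_le_left _ _,
      by linarith [min_le_right 1 (c - a)], fun i => isEmptyElim i, fun m _ i => isEmptyElim i⟩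
  -- a common radius
  have hune : (Finset.univ : Finset ι).Nonempty := Finset.univ_nonempty
  set δ : ℝ := min ((Finset.univ.inf' hune δu)) (Finset.univ.inf' hune δl) with hδdef
  have hδpos : 0 < δ := by
    refine lt_min ?_ ?_
    · exact (Finset.lt_inf'_iff hune).2 fun i _ => hδu i
    · exact (Finset.lt_inf'_iff hune).2 fun k _ => hδl k
  have hδ_u : ∀ i, δ ≤ δu i := fun i =>
    (min_le_left _ _).trans (Finset.inf'_le δu (Finset.mem_univ i))
  have hδ_l : ∀ k, δ ≤ δl k := fun k =>
    (min_le_right _ _).trans (Finset.inf'_le δl (Finset.mem_univ k))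
  obtain ⟨i₀⟩ := hι
  have hδ1 : δ ≤ 1 := (hδ_u i₀).trans (hδu1 i₀)
  have hδc : a + δ ≤ c := by linarith [hδ_u i₀, hδuc i₀]
  -- the exponent threshold
  refine ⟨∑ i, ∑ k, N i * (K k * (M k + 1)), δ, hδpos, hδ1, hδc, ?_, ?_⟩
  · intro i t ht
    exact (hbu i t ⟨ht.1, by linarith [ht.2, hδ_u i]⟩).2
  · intro m hm i k
    -- the exponent `E = N_i · K_k · (M_k + 1) ≤ m + 1`
    set E : ℕ := N i * (K k * (M k + 1)) with hE
    have hEm : E ≤ m + 1 := by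
      have h1 : E ≤ ∑ k', N i * (K k' * (M k' + 1)) :=
        Finset.single_le_sum (f := fun k' => N i * (K k' * (M k' + 1))) (fun _ _ => Nat.zero_le _)
          (Finset.mem_univ k)
      have h2 : ∑ k', N i * (K k' * (M k' + 1)) ≤ ∑ i', ∑ k', N i' * (K k' * (M k' + 1)) :=
        Finset.single_le_sum (f := fun i' => ∑ k', N i' * (K k' * (M k' + 1))) (fun _ _ => Nat.zero_le _)
          (Finset.mem_univ i)
      omega
    refine ⟨Cu i ^ E / Cl k ^ (M k + 1), fun t ht => ?_⟩
    have hs : 0 < t - a := sub_pos.2 ht.1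
    have htu : t ∈ Set.Ioo a (a + δu i) := ⟨ht.1, by linarith [ht.2, hδ_u i]⟩
    have htl : t ∈ Set.Ioo a (a + δl k) := ⟨ht.1, by linarith [ht.2, hδ_l k]⟩
    obtain ⟨hup, hle1⟩ := hbu i t htu
    have hlow := hbl k t htl
    -- numerator
    have hnum : |κ i t| ^ (m + 1) ≤ Cu i ^ E * (t - a) ^ (K k * (M k + 1)) := by
      calc |κ i t| ^ (m + 1) ≤ |κ i t| ^ E := pow_le_pow_of_le_one (abs_nonneg _) hle1 hEm
        _ ≤ (Cu i * (t - a) ^ ((N i : ℝ)⁻¹)) ^ E := pow_le_pow_left₀ (abs_nonneg _) hup E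
        _ = Cu i ^ E * (t - a) ^ (K k * (M k + 1)) := by
          rw [mul_pow]
          congr 1
          show ((t - a) ^ ((N i : ℝ)⁻¹)) ^ (N i * (K k * (M k + 1))) = (t - a) ^ (K k * (M k + 1))
          rw [pow_mul, Real.rpow_inv_natCast_pow hs.le (hN i).ne']
    -- denominator
    have hden : Cl k ^ (M k + 1) * (t - a) ^ (K k * (M k + 1)) ≤ |κ k t| ^ (M k + 1) := by
      calc Cl k ^ (M k + 1) * (t - a) ^ (K k * (M k + 1))
          = (Cl k * (t - a) ^ K k) ^ (M k + 1) := by rw [mul_pow, ← pow_mul]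
        _ ≤ |κ k t| ^ (M k + 1) := pow_le_pow_left₀ (mul_pos (hCl k) (pow_pos hs _)).le hlow _
    have hsP : 0 < (t - a) ^ (K k * (M k + 1)) := pow_pos hs _
    have hdenpos : 0 < Cl k ^ (M k + 1) * (t - a) ^ (K k * (M k + 1)) := mul_pos (pow_pos (hCl k) _) hsP
    calc |κ i t| ^ (m + 1) / |κ k t| ^ (M k + 1)
        ≤ (Cu i ^ E * (t - a) ^ (K k * (M k + 1))) / (Cl k ^ (M k + 1) * (t - a) ^ (K k * (M k + 1))) :=
          div_le_div₀ (mul_nonneg (pow_nonneg (hCu i) _) hsP.le) hnum hdenpos hden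
      _ = Cu i ^ E / Cl k ^ (M k + 1) := by rw [mul_div_mul_right _ _ hsP.ne']

/-! ## §4 Mirror: singular end on the RIGHT (`c⁻`) — by the reflection `t ↦ −t` -/

/-- Reflection `t ↦ −t`: `x ↦ φ (−x₀)` is `ℚ`-semialgebraic on the reflected interval (its graph is the preimage of the graph of `φ` under the
polynomial map `(z₀, z₁) ↦ (−z₀, z₁)`; no Tarski–Seidenberg). -/
theorem isSemialgebraicFunOn_reflect {φ : ℝ → ℝ} {a c : ℝ}
    (hφ : IsSemialgebraicFunOn ℚ {x : Fin 1 → ℝ | x 0 ∈ Set.Ioo a c} (fun x => φ (x 0))) :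
    IsSemialgebraicFunOn ℚ {x : Fin 1 → ℝ | x 0 ∈ Set.Ioo (-c) (-a)} (fun x => φ (-(x 0))) := by
  rw [isSemialgebraicFunOn_iff] at hφ ⊢
  have h := hφ.preimage_aeval (fun j : Fin 2 => if j = 0 then -(MvPolynomial.X 0 : MvPolynomial (Fin 2) ℚ) else MvPolynomial.X 1)
  convert h using 1
  ext z
  simp only [mem_setOf_eq, mem_preimage, Fin.init, Set.mem_Ioo]
  have h0 : (Fin.castSucc (0 : Fin 1) : Fin 2) = 0 := rfl
  have h1 : (Fin.last 1 : Fin 2) = 1 := rfl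
  simp only [h0, h1]
  simp
  intro _
  constructor <;> rintro ⟨h1, h2⟩ <;> exact ⟨by linarith, by linarith⟩

/-- **Rates at a singular RIGHT end.**  Mirror of `rates_at_end` (apply it to `t ↦ κ i (−t)` on `(−c, −a)`). -/
theorem rates_at_end_right {ι : Type*} [Fintype ι] (κ : ι → ℝ → ℝ) (M : ι → ℕ) {a c : ℝ} (hac : a < c)
    (hκ : ∀ i, IsSemialgebraicFunOn ℚ {x : Fin 1 → ℝ | x 0 ∈ Set.Ioo a c} (fun x => κ i (x 0)))
    (h0 : ∀ i, Tendsto (κ i) (𝓝[<] c) (𝓝 0)) (hne : ∀ i, ∀ t ∈ Set.Ioo a c, κ i t ≠ 0) :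
    ∃ (m₀ : ℕ) (δ : ℝ), 0 < δ ∧ δ ≤ 1 ∧ a ≤ c - δ ∧ (∀ i, ∀ t ∈ Set.Ioo (c - δ) c, |κ i t| ≤ 1) ∧
      ∀ m, m₀ ≤ m → ∀ i k, ∃ C : ℝ, ∀ t ∈ Set.Ioo (c - δ) c, |κ i t| ^ (m + 1) / |κ k t| ^ (M k + 1) ≤ C := by
  have hac' : -c < -a := neg_lt_neg hac
  obtain ⟨m₀, δ, hδ, hδ1, hδc, hb, hr⟩ := rates_at_end (fun i t => κ i (-t)) M hac'
    (fun i => isSemialgebraicFunOn_reflect (hκ i))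
    (fun i => (h0 i).comp tendsto_neg_nhdsGT_neg)
    (fun i t ht h => hne i (-t) ⟨by linarith [ht.2], by linarith [ht.1]⟩ h)
  refine ⟨m₀, δ, hδ, hδ1, by linarith, fun i t ht => ?_, fun m hm i k => ?_⟩
  · have h1 := hb i (-t) ⟨by linarith [ht.2], by linarith [ht.1]⟩
    simpa using h1
  · obtain ⟨C, hC⟩ := hr m hm i k
    refine ⟨C, fun t ht => ?_⟩
    have h1 := hC (-t) ⟨by linarith [ht.2], by linarith [ht.1]⟩
    simpa using h1

end Summit.KontsevichZagierPeriods.RootDecompRelativeModAbsolute.Rung30571.RegularisedLogLayer.CylLogLeaf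

/-! ## Part 5 — `Step1Pieces_v3` (g11 companion, verbatim body) -/

namespace Summit.KontsevichZagierPeriods.RootDecompRelativeModAbsolute.Rung30571.RegularisedLogLayer.CylLogLeaf

/-! ## Part A — `QSegments` -/
/-- The piece of `E` right-adjacent to the rational point `r`: points `w` with `(r, w₀] ⊆ E`. -/
def segAbove (E : Set (Fin 1 → ℝ)) (r : ℚ) : Set (Fin 1 → ℝ) :=
  {w | (r : ℝ) < w 0 ∧ ∀ y : ℝ, (r : ℝ) < y → y ≤ w 0 → (fun _ : Fin 1 => y) ∈ E}

/-- The piece of `E` left-adjacent to the rational point `r`: points `w` with `[w₀, r) ⊆ E`. -/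
def segBelow (E : Set (Fin 1 → ℝ)) (r : ℚ) : Set (Fin 1 → ℝ) :=
  {w | w 0 < (r : ℝ) ∧ ∀ y : ℝ, w 0 ≤ y → y < (r : ℝ) → (fun _ : Fin 1 => y) ∈ E}

/-- Auxiliary step `segAbove_subset` (§4): seg Above subset. [bookkeeping] -/
theorem segAbove_subset (E : Set (Fin 1 → ℝ)) (r : ℚ) : segAbove E r ⊆ E := by
  intro w hw
  have h := hw.2 (w 0) hw.1 le_rfl
  have hw0 : (fun _ : Fin 1 => w 0) = w := by
    funext i; rw [Subsingleton.elim i 0]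
  rwa [hw0] at h

/-- Auxiliary step `segBelow_subset` (§4): seg Below subset. [bookkeeping] -/
theorem segBelow_subset (E : Set (Fin 1 → ℝ)) (r : ℚ) : segBelow E r ⊆ E := by
  intro w hw
  have h := hw.2 (w 0) le_rfl hw.1
  have hw0 : (fun _ : Fin 1 => w 0) = w := by
    funext i; rw [Subsingleton.elim i 0]
  rwa [hw0] at h

/-- Order-convexity towards `r`. -/
theorem mem_segAbove_of_le {E : Set (Fin 1 → ℝ)} {r : ℚ} {w w' : Fin 1 → ℝ} (hw : w ∈ segAbove E r)
    (h1 : (r : ℝ) < w' 0) (h2 : w' 0 ≤ w 0) : w' ∈ segAbove E r :=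
  ⟨h1, fun y hy hy' => hw.2 y hy (hy'.trans h2)⟩

/-- Auxiliary step `mem_segBelow_of_le` (§4): mem seg Below of le. [bookkeeping] -/
theorem mem_segBelow_of_le {E : Set (Fin 1 → ℝ)} {r : ℚ} {w w' : Fin 1 → ℝ} (hw : w ∈ segBelow E r)
    (h1 : w 0 ≤ w' 0) (h2 : w' 0 < (r : ℝ)) : w' ∈ segBelow E r :=
  ⟨h2, fun y hy hy' => hw.2 y (h1.trans hy) hy'⟩

/-- The cylinder `{v : ℝ² | (v₀) ∈ E}` is `ℚ`-semialgebraic. -/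
private theorem isSemialgebraic_cyl {E : Set (Fin 1 → ℝ)} (hE : IsSemialgebraic ℚ E) :
    IsSemialgebraic ℚ {v : Fin 2 → ℝ | (fun _ : Fin 1 => v 0) ∈ E} := by
  exact hE.preimage_comp (fun _ : Fin 1 => (0 : Fin 2))

/-- **`segAbove E r` is `ℚ`-semialgebraic** (Tarski–Seidenberg over `ℚ`). -/
theorem isSemialgebraic_segAbove {E : Set (Fin 1 → ℝ)} (hE : IsSemialgebraic ℚ E) (r : ℚ) :
    IsSemialgebraic ℚ (segAbove E r) := by
  classical
  -- the "bad witnesses": `v = (y, x)` with `r < y ≤ x`, `(y) ∉ E`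
  let B : Set (Fin 2 → ℝ) :=
    {v | (r : ℝ) < v 0} ∩ ({v | v 0 ≤ v 1} ∩ {v : Fin 2 → ℝ | (fun _ : Fin 1 => v 0) ∈ E}ᶜ)
  have hB : IsSemialgebraic ℚ B := by
    refine IsSemialgebraic.inter ?_ (IsSemialgebraic.inter ?_ (isSemialgebraic_cyl hE).compl)
    · simpa using isSemialgebraic_setOf_eval_lt (k := ℚ) (R := ℝ) (ι := Fin 2) (MvPolynomial.C r) (MvPolynomial.X 0)
    · simpa using isSemialgebraic_setOf_eval_le (k := ℚ) (R := ℝ) (ι := Fin 2) (MvPolynomial.X 0) (MvPolynomial.X 1)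
  have hA : IsSemialgebraic ℚ {w : Fin 1 → ℝ | (r : ℝ) < w 0} := by
    simpa using isSemialgebraic_setOf_eval_lt (k := ℚ) (R := ℝ) (ι := Fin 1) (MvPolynomial.C r) (MvPolynomial.X 0)
  have himg := hB.image_tail
  have hset : segAbove E r = {w : Fin 1 → ℝ | (r : ℝ) < w 0} \
      ((fun v : Fin (1 + 1) → ℝ => fun i : Fin 1 => v i.succ) '' B) := by
    ext w
    simp only [segAbove, mem_setOf_eq, Set.mem_sdiff, mem_image, not_exists, not_and]
    constructor
    · rintro ⟨hr, hall⟩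
      refine ⟨hr, fun v hv hvw => ?_⟩
      have hv1 : v 1 = w 0 := by
        have := congr_fun hvw 0
        simpa using this
      simp only [B, mem_inter_iff, mem_setOf_eq, mem_compl_iff] at hv
      exact hv.2.2 (hall (v 0) hv.1 (hv1 ▸ hv.2.1))
    · rintro ⟨hr, hno⟩
      refine ⟨hr, fun y hy hyw => ?_⟩
      by_contra hyE
      refine hno (fun i => if i = 0 then y else w 0) ?_ ?_
      · simp only [B, mem_inter_iff, mem_setOf_eq, mem_compl_iff]
        exact ⟨by simpa using hy, by simpa using hyw, by simpa using hyE⟩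
      · funext i
        rw [Subsingleton.elim i 0]
        simp
  rw [hset]
  exact hA.diff himg

/-- **`segBelow E r` is `ℚ`-semialgebraic.** -/
theorem isSemialgebraic_segBelow {E : Set (Fin 1 → ℝ)} (hE : IsSemialgebraic ℚ E) (r : ℚ) :
    IsSemialgebraic ℚ (segBelow E r) := by
  classical
  let B : Set (Fin 2 → ℝ) :=
    {v | v 0 < (r : ℝ)} ∩ ({v | v 1 ≤ v 0} ∩ {v : Fin 2 → ℝ | (fun _ : Fin 1 => v 0) ∈ E}ᶜ)
  have hB : IsSemialgebraic ℚ B := by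
    refine IsSemialgebraic.inter ?_ (IsSemialgebraic.inter ?_ (isSemialgebraic_cyl hE).compl)
    · simpa using isSemialgebraic_setOf_eval_lt (k := ℚ) (R := ℝ) (ι := Fin 2) (MvPolynomial.X 0) (MvPolynomial.C r)
    · simpa using isSemialgebraic_setOf_eval_le (k := ℚ) (R := ℝ) (ι := Fin 2) (MvPolynomial.X 1) (MvPolynomial.X 0)
  have hA : IsSemialgebraic ℚ {w : Fin 1 → ℝ | w 0 < (r : ℝ)} := by
    simpa using isSemialgebraic_setOf_eval_lt (k := ℚ) (R := ℝ) (ι := Fin 1) (MvPolynomial.X 0) (MvPolynomial.C r)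
  have himg := hB.image_tail
  have hset : segBelow E r = {w : Fin 1 → ℝ | w 0 < (r : ℝ)} \
      ((fun v : Fin (1 + 1) → ℝ => fun i : Fin 1 => v i.succ) '' B) := by
    ext w
    simp only [segBelow, mem_setOf_eq, Set.mem_sdiff, mem_image, not_exists, not_and]
    constructor
    · rintro ⟨hr, hall⟩
      refine ⟨hr, fun v hv hvw => ?_⟩
      have hv1 : v 1 = w 0 := by
        have := congr_fun hvw 0
        simpa using this
      simp only [B, mem_inter_iff, mem_setOf_eq, mem_compl_iff] at hv
      exact hv.2.2 (hall (v 0) (hv1 ▸ hv.2.1) hv.1)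
    · rintro ⟨hr, hno⟩
      refine ⟨hr, fun y hwy hy => ?_⟩
      by_contra hyE
      refine hno (fun i => if i = 0 then y else w 0) ?_ ?_
      · simp only [B, mem_inter_iff, mem_setOf_eq, mem_compl_iff]
        exact ⟨by simpa using hy, by simpa using hwy, by simpa using hyE⟩
      · funext i
        rw [Subsingleton.elim i 0]
        simp
  rw [hset]
  exact hA.diff himg

/-- For open `E`, `segAbove E r` is open. -/
theorem isOpen_segAbove {E : Set (Fin 1 → ℝ)} (hE : IsOpen E) (r : ℚ) : IsOpen (segAbove E r) := by
  rw [isOpen_iff_mem_nhds]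
  intro w hw
  -- `E` contains a box around `w`; points slightly above `w 0` still have `(r, ·] ⊆ E`
  have hwE : w ∈ E := segAbove_subset E r hw
  obtain ⟨ε, hε, hball⟩ := Metric.isOpen_iff.1 hE w hwE
  have hr := hw.1
  refine Filter.mem_of_superset (Metric.ball_mem_nhds w (lt_min hε (sub_pos.2 hr))) fun w' hw' => ?_
  rw [Metric.mem_ball] at hw'
  have h0 : dist (w' 0) (w 0) < min ε ((w 0) - r) := lt_of_le_of_lt (dist_le_pi_dist w' w 0) hw'
  rw [Real.dist_eq] at h0
  have h0' := (abs_lt.1 h0)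
  refine ⟨by linarith [min_le_right ε (w 0 - (r : ℝ)), h0'.1], fun y hy hyw' => ?_⟩
  by_cases hyw : y ≤ w 0
  · exact hw.2 y hy hyw
  · -- `w 0 < y ≤ w' 0 < w 0 + ε`: inside the ball around `w`
    apply hball
    rw [Metric.mem_ball, dist_pi_lt_iff hε]
    intro i
    rw [Subsingleton.elim i 0, Real.dist_eq]
    have h1 : w 0 < y := lt_of_not_ge hyw
    rw [abs_lt]
    constructor <;> linarith [min_le_left ε (w 0 - (r : ℝ)), h0'.2]

/-- For open `E`, `segBelow E r` is open. -/
theorem isOpen_segBelow {E : Set (Fin 1 → ℝ)} (hE : IsOpen E) (r : ℚ) : IsOpen (segBelow E r) := by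
  rw [isOpen_iff_mem_nhds]
  intro w hw
  have hwE : w ∈ E := segBelow_subset E r hw
  obtain ⟨ε, hε, hball⟩ := Metric.isOpen_iff.1 hE w hwE
  have hr := hw.1
  refine Filter.mem_of_superset (Metric.ball_mem_nhds w (lt_min hε (sub_pos.2 hr))) fun w' hw' => ?_
  rw [Metric.mem_ball] at hw'
  have h0 : dist (w' 0) (w 0) < min ε ((r : ℝ) - w 0) := lt_of_le_of_lt (dist_le_pi_dist w' w 0) hw'
  rw [Real.dist_eq] at h0
  have h0' := (abs_lt.1 h0)
  refine ⟨by linarith [min_le_right ε ((r : ℝ) - w 0), h0'.2], fun y hyw' hy => ?_⟩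
  by_cases hyw : w 0 ≤ y
  · exact hw.2 y hyw hy
  · apply hball
    rw [Metric.mem_ball, dist_pi_lt_iff hε]
    intro i
    rw [Subsingleton.elim i 0, Real.dist_eq]
    have h1 : y < w 0 := lt_of_not_ge hyw
    rw [abs_lt]
    constructor <;> linarith [min_le_left ε ((r : ℝ) - w 0), h0'.1]

/-- The two halves at one rational point are disjoint. -/
theorem disjoint_segBelow_segAbove (E : Set (Fin 1 → ℝ)) (r : ℚ) : Disjoint (segBelow E r) (segAbove E r) :=
  Set.disjoint_left.2 fun _ h1 h2 => (lt_irrefl _ (h1.1.trans h2.1)).elim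

/-- Pieces attached to rational points SEPARATED by a point outside `E` are disjoint (all four combinations). -/
theorem disjoint_seg_of_separated {E : Set (Fin 1 → ℝ)} {r r' : ℚ} {f : ℝ} (hrf : (r : ℝ) < f) (hfr' : f < (r' : ℝ))
    (hf : (fun _ : Fin 1 => f) ∉ E) :
    Disjoint (segAbove E r) (segBelow E r') ∧ Disjoint (segAbove E r) (segAbove E r') ∧
      Disjoint (segBelow E r) (segBelow E r') ∧ Disjoint (segBelow E r) (segAbove E r') := by
  refine ⟨?_, ?_, ?_, ?_⟩ <;> refine Set.disjoint_left.2 fun w h1 h2 => ?_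
  · -- (r, w0] ⊆ E and [w0, r') ⊆ E put `f` in `E`
    by_cases hfw : f ≤ w 0
    · exact hf (h1.2 f hrf hfw)
    · exact hf (h2.2 f (lt_of_not_ge hfw).le hfr')
  · exact hf (h1.2 f hrf ((hfr'.trans h2.1).le))
  · exact hf (h2.2 f (h1.1.trans hrf).le hfr')
  · exact absurd (h1.1.trans (hrf.trans (hfr'.trans h2.1))) (lt_irrefl _)

end Summit.KontsevichZagierPeriods.RootDecompRelativeModAbsolute.Rung30571.RegularisedLogLayer.CylLogLeaf
end
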